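import Summits.HodgeConjecture.HodgeCM.Model.ArchSideTerm
import Literature.NumberTheory.Weil1964.ThetaLiftTransportAdelic
import Literature.NumberTheory.GelbartRogawski1991.UnitaryDualPairSeesawCMLinesCollapse
import Literature.NumberTheory.GelbartRogawski1991.UnitaryDualPairCMLineTorus
import HarnessLib

/-!
# FLOOR-0 P4, seat J-R — RALLIS→MODEL TRANSPORT AT THE LINE: the model's slot-0 theta lift is, up to an automorphic
# twist and the carrier isomorphisms, the theta lift of the UNITARY DUAL PAIR `(U(diag dV), U(⟨a₀⟩))` of S6

Cell hodgecm-mathlib (D-0151), FLOOR 0, crux item H413 = stmt-HodgeConjecture-24833; programme P4, line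
`Cruxes/H413/Lines/F0_P4AdmissibleOccursInH1.lean`, stub S4′ `stub_T3a_holThetaRealisationOfRallisAt` (road (ii-β) of DECISIONS-T3a:
S6 = [Li1992, Thm 2.1] ⇒ `θ_t ≠ 0`).  Author F0P4-p05 (g0).  `--supports stmt-HodgeConjecture-24833` (helper; closes no stub by itself).

THE GAP THIS FILE CLOSES.  S6 (★ `Li1992.RallisInnerProductFormulaUnitaryDualPair`) and its non-vanishing corollaries
(★ `RallisInnerProductIdentity.thetaLift_ne_zero_of_re_pos`, ★ `thetaLift_charCM_ne_zero_of_re_pos`) speak about the theta lift of the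
tree's CONSTRUCTED unitary dual pair `UnitaryDualPair.thetaKernelDatum …` on the carriers
`UnitaryGroup.adelic L⁺ L c 3 (diagonal dV) × UnitaryGroup.adelic L⁺ L c 1 (diagonal (lineVec a₀))` with arithmetic subgroups the
`toAdelic` ranges — in the CM currency, `cmThetaKernelDatum L e₁ dV … (lineVec a₀) … hGR₀ hρ SK hSK` on `CMAdelic L dV × CMAdelic L (lineVec a₀)`.
The LINE's theta distributions (DECISIONS D2: `D₀ = thetaDistDatumZeroOf…`, ★ `ThetaDistDatum.dist`, F0P4-p01's `H413ThetaDistAtLine`)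
lift through the MODEL datum `(S.P 0).kernelDatum = ThetaKernelDatum.adelicOfDualPairRep (S.P 0).ω …` (`SupplyResidual`), whose pair
group is `↥(regimeSubgroup L V.Hm) × ↥(relNormOneIdeles L⁺ L)` with arithmetic subgroups `regimeRat` and `relNormOneRat`, and whose
representation is `(S.P 0).ω = lineRepOf V S hGR hGR₀ hGR₁ hGR₂ hGR₃ η₀ η₁ η₂ η₃ 0` (`ArchSideTerm`; `rfl` for `archSideOfChar`,
`archSideOf`, `archSideOfT`, `ThetaDistAtLine.sideAt`).  By ★ `cmLineRepFin₀_apply_eq_smul_cmPairRep` ([Howe1979, §3];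
[GelbartRogawski1991, §3.1 Remark p. 457 L4–13]) the two representations agree along the carrier isomorphisms
`eU = cmFrameEquiv ∘ (regimeSubgroup ↪ U(V.Hm)(𝔸))` and `e : t ↦ t♭ · 1₁` up to the scalar character
`c(x, t) = η₀(eU x, t♭) · χ₀(eU x, e t)` (`χ₀ = cmLineChar₀`, the see-saw character).  Hence, by the generic transport
★ `Weil1964.ThetaKernelDatum.thetaLift_ne_zero_iff_of_twist` (`ThetaLiftTransportAdelic`):

* §1 **(T) at slot 0** (`lineRepOf_zero_apply_eq_smul`): `lineRepOf … 0 (x, t) Φ = (η₀(eU x, t♭) · χ₀(eU x, e t)) • cmPairRep e₁ hGR₀ (eU x, e t) Φ`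
  for ANY isomorphisms `eU`, `e` with the displayed values (`heU`, `he`; the tree's `regimeEquiv⁻¹ ≫ cmFrameEquiv` and
  `cmLineTorusEquiv` qualify), and the twist packaged as a homomorphism (`exists_twist_lineRepOf_zero`);
* §2 **THE ARITHMETIC SUBGROUPS CORRESPOND** along `eU` (`mem_CMRat_iff_mem_regimeRat`: `eU x ∈ U(diag dV)(L⁺) ↔ x ∈ regimeRat`);
* §3 **MAIN** (`kernelDatum_thetaLift_ne_zero_iff`): for every `P : WeilPairData L⁺ L (Fin 3) ↥(regimeSubgroup L V.Hm)` with
  `P.ω = lineRepOf … 0` and `P.ΓU = regimeRat L V.Hm`, every finite measure `μ′` on `[U(1)] = relNormOneIdeles ⧸ relNormOneRat`, every `Φ`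
  and every `f′ ∈ C([U(1)])`, and every continuous `c₂` on `[U(1)]` descending `t ↦ c(1,t)⁻¹`:
  `P.kernelDatum.thetaLift μ′ Φ f′ ≠ 0 ↔ (cmThetaKernelDatum L e₁ (frameD V) … (lineVec (dW S 0)) … hGR₀ hρ SK hSK).thetaLift (μ′.map a) Φ ((c₂·f′) ∘ a⁻¹) ≠ 0`,
  `a = cosetCongr e` — the right-hand datum being LITERALLY S6's `UnitaryDualPair.thetaKernelDatum L⁺ L c 3 1 e₁ (diagonal (frameD V))
  (diagonal (lineVec (dW S 0))) … (splittingOf hGR₀) … hρ SK hSK` (`cmThetaKernelDatum` unfolds to it), its measure `μ′.map a` finite,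
  `U(⟨a₀⟩)(𝔸)`-invariant and open-positive whenever `μ′` is (★ `CosetSpaceLpTransport`), as S6's `μ`-binders require; and the twist is
  AUTOMORPHIC (`twist_eq_one`: `c = 1` on `regimeRat × relNormOneRat`, from the two theta-stabiliser conditions alone).

What is NOT here (other seats): the junction `ω_V(t) ↔ D₀.ωf` (J, F0P4-p01), the instantiation of S6's remaining binders at the CM line
(F0P4-p08), `hiso` (F0P4-p06 ∕ p04), the positivity ∕ local occupancy of the `χ̄`-Fourier coefficient (F0P4-p02, p07), and the
identification of `(c₂ · charInv χ) ∘ a⁻¹` with `charCM` of the transported automorphic character (sequel).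
HC_CM is proved only modulo the printed citations until rung 0 closes; this file proves nothing about them.

## References (conventions only; nothing of print is asserted)
* [Howe1979] R. Howe, *θ-series and invariant theory*, Proc. Sympos. Pure Math. 33.1 (1979), §3.
* [GelbartRogawski1991] S. Gelbart, J. Rogawski, Invent. Math. 105 (1991), §3.1 Remark p. 457 L4–13.
* [Li1992] J.-S. Li, J. reine angew. Math. 428 (1992), Thm 2.1 p. 184 (the consumer, S6).
* [Weil1964] A. Weil, Acta Math. 111 (1964), Chap. III n° 41 Thm 6 p. 193.
-/

set_option autoImplicit false
set_option linter.dupNamespace false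

noncomputable section

open _root_.MeasureTheory
open NumberField hiding relNormOneIdeles relNormOneRat probHaarRelNormOneQuot
open scoped Matrix
open Literature.NumberTheory.Automorphic Literature.NumberTheory.Automorphic.UnitaryGroup Literature.NumberTheory.Weil1964
open Literature.NumberTheory.Weil1964.ThetaKernelDatum
open Literature.NumberTheory.GelbartRogawski1991 Literature.NumberTheory.GelbartRogawski1991.UnitaryDualPair
open Literature.MeasureTheory.Group
open HodgeCM HodgeCM.Adelic HodgeCM.PerL34 HodgeCM.Model HodgeCM.Model.ArchSideTerm HodgeCM.Model.SupplyResidual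

namespace Summit.HodgeConjecture.HodgeConjecture.Cruxes.H413.RallisTransport

variable {L : CMField} {ι₁ : L →+* ℂ} (V : HermSpace3 L ι₁) (S : StubTree.SeesawDatum L)
variable
  (hGR : (cmSplittingDatum (L : Type) finProdFinEquiv (frameD V) (frameD_real V) (frameD_ne V) (dW S) (dW_real S) (dW_ne S)).CompatibleSplitting)
  (hGR₀ : (cmSplittingDatum (L : Type) (e₁) (frameD V) (frameD_real V) (frameD_ne V) (lineVec (L : Type) (dW S 0))
    (fun _ => dW_real S 0) (fun _ => dW_ne S 0)).CompatibleSplitting)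
  (hGR₁ : (cmSplittingDatum (L : Type) (e₁) (frameD V) (frameD_real V) (frameD_ne V) (lineVec (L : Type) (dW S 1))
    (fun _ => dW_real S 1) (fun _ => dW_ne S 1)).CompatibleSplitting)
  (hGR₂ : (cmSplittingDatum (L : Type) (e₁) (frameD V) (frameD_real V) (frameD_ne V) (lineVec (L : Type) (dW' S 0))
    (fun _ => dW'_real S 0) (fun _ => dW'_ne S 0)).CompatibleSplitting)
  (hGR₃ : (cmSplittingDatum (L : Type) (e₁) (frameD V) (frameD_real V) (frameD_ne V) (lineVec (L : Type) (dW' S 1))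
    (fun _ => dW'_real S 1) (fun _ => dW'_ne S 1)).CompatibleSplitting)
  (η₀ η₁ η₂ η₃ : CMAdelic (L : Type) (frameD V) × CMAdelicOne (L : Type) →* ℂˣ)
  (eU : ↥(regimeSubgroup L V.Hm) ≃* CMAdelic (L : Type) (frameD V))
  (heU : ∀ x : ↥(regimeSubgroup L V.Hm),
    eU x = cmFrameEquiv (L : Type) (frameG V) V.Hm (frameD V) (frame_congr V) (x : ↥(HodgeCM.Adelic.adelicUnitaryGroup (L : Type) V.Hm)))
  (e : ↥(relNormOneIdeles (↥(maximalRealSubfield L)) L) ≃* CMAdelic (L : Type) (lineVec (L : Type) (dW S 0)))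
  (he : ∀ t : ↥(relNormOneIdeles (↥(maximalRealSubfield L)) L),
    e t = CMCenter (L : Type) (lineVec (L : Type) (dW S 0)) ((cmAdelicOneEquivRelNormOne (L : Type)).symm t))

/-! ## §1 (T): the slot-0 line representation is a twist of the small pair's Weil representation -/

include heU he in
/-- **(T) at slot 0**: `lineRepOf … 0 (x, t) Φ = (η₀(eU x, t♭) · χ₀(eU x, e t)) • cmPairRep e₁ hGR₀ (eU x, e t) Φ` — ★
`cmLineRepFin₀_apply_eq_smul_cmPairRep` read along the carrier isomorphisms `eU` (values `cmFrameEquiv`) and `e` (values `t♭ · 1₁`).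
[cite: Howe1979, §3; GelbartRogawski1991, §3.1 Remark p. 457 L4–13] -/
theorem lineRepOf_zero_apply_eq_smul (p : ↥(regimeSubgroup L V.Hm) × ↥(relNormOneIdeles (↥(maximalRealSubfield L)) L))
    (Φ : piSchwartzBruhat (↥(maximalRealSubfield L)) (Fin 3)) :
    lineRepOf V S hGR hGR₀ hGR₁ hGR₂ hGR₃ η₀ η₁ η₂ η₃ 0 p Φ =
      ((η₀ (eU p.1, (cmAdelicOneEquivRelNormOne (L : Type)).symm p.2) *
            cmLineChar₀ (L : Type) finProdFinEquiv e₁ (frameD V) (frameD_real V) (frameD_ne V) (dW S) (dW_real S) (dW_ne S)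
              hGR hGR₀ hGR₁ (eU p.1, e p.2) : ℂˣ) : ℂ) •
        cmPairRep (L : Type) e₁ (frameD V) (frameD_real V) (frameD_ne V) (lineVec (L : Type) (dW S 0)) (fun _ => dW_real S 0)
          (fun _ => dW_ne S 0) hGR₀ (eU p.1, e p.2) Φ := by
  obtain ⟨x, t⟩ := p
  have h := cmLineRepFin₀_apply_eq_smul_cmPairRep (L : Type) finProdFinEquiv e₁ (frameD V) (frameD_real V) (frameD_ne V)
    (dW S) (dW_real S) (dW_ne S) hGR hGR₀ hGR₁ η₀
    (cmFrameEquiv (L : Type) (frameG V) V.Hm (frameD V) (frame_congr V) (x : ↥(HodgeCM.Adelic.adelicUnitaryGroup (L : Type) V.Hm)))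
    t Φ
  dsimp only
  rw [heU, he]
  exact h

include heU he in
/-- **The twist packaged as a homomorphism** `c : regimeSubgroup × relNormOneIdeles →* ℂˣ` with
`c(x, t) = η₀(eU x, t♭) · χ₀(eU x, e t)` and `lineRepOf … 0 p Φ = c(p) • cmPairRep e₁ hGR₀ (eU p.1, e p.2) Φ` — the shape (T) of
`Weil1964/ThetaLiftTransportAdelic`. [cite: Howe1979, §3; GelbartRogawski1991, §3.1 Remark p. 457 L4–13] -/
theorem exists_twist_lineRepOf_zero :
    ∃ c : ↥(regimeSubgroup L V.Hm) × ↥(relNormOneIdeles (↥(maximalRealSubfield L)) L) →* ℂˣ,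
      (∀ p, c p = η₀ (eU p.1, (cmAdelicOneEquivRelNormOne (L : Type)).symm p.2) *
          cmLineChar₀ (L : Type) finProdFinEquiv e₁ (frameD V) (frameD_real V) (frameD_ne V) (dW S) (dW_real S) (dW_ne S)
            hGR hGR₀ hGR₁ (eU p.1, e p.2)) ∧
      ∀ (p : ↥(regimeSubgroup L V.Hm) × ↥(relNormOneIdeles (↥(maximalRealSubfield L)) L))
        (Φ : piSchwartzBruhat (↥(maximalRealSubfield L)) (Fin 3)),
        lineRepOf V S hGR hGR₀ hGR₁ hGR₂ hGR₃ η₀ η₁ η₂ η₃ 0 p Φ =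
          ((c p : ℂˣ) : ℂ) • cmPairRep (L : Type) e₁ (frameD V) (frameD_real V) (frameD_ne V) (lineVec (L : Type) (dW S 0))
            (fun _ => dW_real S 0) (fun _ => dW_ne S 0) hGR₀ (eU p.1, e p.2) Φ := by
  let flat : ↥(relNormOneIdeles (↥(maximalRealSubfield L)) L) →* CMAdelicOne (L : Type) :=
    (cmAdelicOneEquivRelNormOne (L : Type)).symm.toMonoidHom
  let c : ↥(regimeSubgroup L V.Hm) × ↥(relNormOneIdeles (↥(maximalRealSubfield L)) L) →* ℂˣ :=
    (η₀.comp (eU.toMonoidHom.prodMap flat)) *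
      ((cmLineChar₀ (L : Type) finProdFinEquiv e₁ (frameD V) (frameD_real V) (frameD_ne V) (dW S) (dW_real S) (dW_ne S)
        hGR hGR₀ hGR₁).comp (eU.toMonoidHom.prodMap e.toMonoidHom))
  have hc : ∀ p, c p = η₀ (eU p.1, (cmAdelicOneEquivRelNormOne (L : Type)).symm p.2) *
      cmLineChar₀ (L : Type) finProdFinEquiv e₁ (frameD V) (frameD_real V) (frameD_ne V) (dW S) (dW_real S) (dW_ne S)
        hGR hGR₀ hGR₁ (eU p.1, e p.2) := fun p => rfl
  exact ⟨c, hc, fun p Φ => by rw [hc]; exact lineRepOf_zero_apply_eq_smul V S hGR hGR₀ hGR₁ hGR₂ hGR₃ η₀ η₁ η₂ η₃ eU heU e he p Φ⟩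

/-! ## §2 The arithmetic subgroups correspond along `eU` -/

include heU in
/-- **`eU x ∈ U(diag dV)(L⁺) ↔ x ∈ regimeRat`**: the frame transport `g⁻¹ · g` by the RATIONAL frame `g = frameG V` and the
identification `cmAdelicEquiv` respect rational points in both directions. [cite: GelbartRogawski1991, §3.1 Prop. 3.1.1 p. 455 L1–3] -/
theorem mem_CMRat_iff_mem_regimeRat (x : ↥(regimeSubgroup L V.Hm)) :
    eU x ∈ CMRat (L : Type) (frameD V) ↔ x ∈ regimeRat L V.Hm := by
  rw [heU, mem_regimeRat_iff]
  unfold cmFrameEquiv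
  rw [ContinuousMulEquiv.trans_apply, cmAdelicEquiv_mem_range_toAdelic_iff]
  constructor
  · intro h
    have h' := adelicUnitaryGroupCongr_mem_rat (L : Type) (frameG V) V.Hm (Matrix.diagonal (frameD V)) (frame_congr V) h
    have hx : adelicUnitaryGroupCongr (L : Type) (frameG V) V.Hm (Matrix.diagonal (frameD V)) (frame_congr V)
        (adelicUnitaryGroupCongr (L : Type) (frameG V)⁻¹ (Matrix.diagonal (frameD V)) V.Hm
          (congr_inv_of_congr (L : Type) (frameG V) V.Hm _ (frame_congr V))
          (x : ↥(HodgeCM.Adelic.adelicUnitaryGroup (L : Type) V.Hm))) =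
        (x : ↥(HodgeCM.Adelic.adelicUnitaryGroup (L : Type) V.Hm)) := by
      apply Subtype.ext
      rw [coe_adelicUnitaryGroupCongr, coe_adelicUnitaryGroupCongr, map_inv, inv_inv]
      group
    rwa [hx] at h'
  · intro h
    exact adelicUnitaryGroupCongr_mem_rat (L : Type) (frameG V)⁻¹ (Matrix.diagonal (frameD V)) V.Hm _ h

/-! ## §3 MAIN: the model's slot-0 lift versus the unitary dual pair's lift -/

section Main

variable (P : WeilPairData (↥(maximalRealSubfield L)) (L : Type) (Fin 3) ↥(regimeSubgroup L V.Hm))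
  (hPω : P.ω = lineRepOf V S hGR hGR₀ hGR₁ hGR₂ hGR₃ η₀ η₁ η₂ η₃ 0) (hPΓ : P.ΓU = regimeRat L V.Hm)
  (hΓ : ∀ t : ↥(relNormOneIdeles (↥(maximalRealSubfield L)) L),
    e t ∈ CMRat (L : Type) (lineVec (L : Type) (dW S 0)) ↔ t ∈ relNormOneRat (↥(maximalRealSubfield L)) L)
  (hρ : HasThetaMajorants fun
    (p : CMAdelic (L : Type) (frameD V) × CMAdelic (L : Type) (lineVec (L : Type) (dW S 0)))
    (Φ : piSchwartzBruhat (↥(maximalRealSubfield L)) (Fin 3)) =>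
      cmPairRep (L : Type) e₁ (frameD V) (frameD_real V) (frameD_ne V) (lineVec (L : Type) (dW S 0))
        (fun _ => dW_real S 0) (fun _ => dW_ne S 0) hGR₀ p Φ)
  (SK : Set (piSchwartzBruhat (↥(maximalRealSubfield L)) (Fin 3)))
  (hSK : ∀ (h : CMAdelic (L : Type) (lineVec (L : Type) (dW S 0))) (Φ : piSchwartzBruhat (↥(maximalRealSubfield L)) (Fin 3)),
    Φ ∈ SK → cmPairRep (L : Type) e₁ (frameD V) (frameD_real V) (frameD_ne V) (lineVec (L : Type) (dW S 0))
      (fun _ => dW_real S 0) (fun _ => dW_ne S 0) hGR₀ (1, h) Φ ∈ SK)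

include heU he hPω hPΓ hΓ in
/-- **THE TWIST IS AUTOMORPHIC at the line**: `η₀(eU γ, γ′♭) · χ₀(eU γ, e γ′) = 1` for `γ ∈ regimeRat`, `γ′ ∈ relNormOneRat` — from the
model's (W-rat⁺) `P.theta_rat` and the tree's `cmPairRep_toHomUnits_mem_thetaStabilizer`, by ★ `twist_eq_one_of_mem` (`Θ ≠ 0`).
[cite: Weil1964, Chap. III n° 41 Thm 6 p. 193; GelbartRogawski1991, §3.1 Remark p. 457 L4–13] -/
theorem twist_eq_one {γ : ↥(regimeSubgroup L V.Hm)} (hγ : γ ∈ regimeRat L V.Hm)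
    {γ' : ↥(relNormOneIdeles (↥(maximalRealSubfield L)) L)}
    (hγ' : γ' ∈ relNormOneRat (↥(maximalRealSubfield L)) L) :
    η₀ (eU γ, (cmAdelicOneEquivRelNormOne (L : Type)).symm γ') *
        cmLineChar₀ (L : Type) finProdFinEquiv e₁ (frameD V) (frameD_real V) (frameD_ne V) (dW S) (dW_real S) (dW_ne S)
          hGR hGR₀ hGR₁ (eU γ, e γ') = 1 := by
  obtain ⟨c, hc, hT⟩ := exists_twist_lineRepOf_zero V S hGR hGR₀ hGR₁ hGR₂ hGR₃ η₀ η₁ η₂ η₃ eU heU e he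
  have hU : ∀ x : ↥(regimeSubgroup L V.Hm), eU x ∈ CMRat (L : Type) (frameD V) ↔ x ∈ P.ΓU := fun x => by
    rw [hPΓ]; exact mem_CMRat_iff_mem_regimeRat V eU heU x
  have hωω' : ∀ (p : ↥(regimeSubgroup L V.Hm) × ↥(relNormOneIdeles (↥(maximalRealSubfield L)) L))
      (Φ : piSchwartzBruhat (↥(maximalRealSubfield L)) (Fin 3)),
      P.ω p Φ = ((c p : ℂˣ) : ℂ) • cmPairRep (L : Type) e₁ (frameD V) (frameD_real V) (frameD_ne V) (lineVec (L : Type) (dW S 0))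
        (fun _ => dW_real S 0) (fun _ => dW_ne S 0) hGR₀ (eU p.1, e p.2) Φ := fun p Φ => by
    rw [hPω]; exact hT p Φ
  have key : c (γ, γ') = 1 :=
    twist_eq_one_of_mem (ΓU := CMRat (L : Type) (frameD V)) (Γ := CMRat (L : Type) (lineVec (L : Type) (dW S 0)))
      (ΓU' := P.ΓU) (Γ' := relNormOneRat (↥(maximalRealSubfield L)) L)
      (cmPairRep (L : Type) e₁ (frameD V) (frameD_real V) (frameD_ne V) (lineVec (L : Type) (dW S 0)) (fun _ => dW_real S 0)
        (fun _ => dW_ne S 0) hGR₀)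
      (fun γU hγU γ hγ => cmPairRep_toHomUnits_mem_thetaStabilizer (L : Type) e₁ (frameD V) (frameD_real V) (frameD_ne V)
        (lineVec (L : Type) (dW S 0)) (fun _ => dW_real S 0) (fun _ => dW_ne S 0) hGR₀ hγU hγ)
      P.ω P.toHomUnits_mem_thetaStabilizer eU hU e hΓ c hωω' (by rw [hPΓ]; exact hγ) hγ'
  rw [hc] at key
  exact key

variable [MeasurableSpace (CMAdelic (L : Type) (lineVec (L : Type) (dW S 0)) ⧸ CMRat (L : Type) (lineVec (L : Type) (dW S 0)))]
  [BorelSpace (CMAdelic (L : Type) (lineVec (L : Type) (dW S 0)) ⧸ CMRat (L : Type) (lineVec (L : Type) (dW S 0)))]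
  [CompactSpace (CMAdelic (L : Type) (frameD V) ⧸ CMRat (L : Type) (frameD V))]
  [CompactSpace (CMAdelic (L : Type) (lineVec (L : Type) (dW S 0)) ⧸ CMRat (L : Type) (lineVec (L : Type) (dW S 0)))]
  [CompactSpace (↥(regimeSubgroup L V.Hm) ⧸ P.ΓU)]
  (μ' : Measure (↥(relNormOneIdeles (↥(maximalRealSubfield L)) L) ⧸
    relNormOneRat (↥(maximalRealSubfield L)) L)) [IsFiniteMeasure μ']

include heU he hPω hPΓ in
/-- **MAIN — THE MODEL'S SLOT-0 THETA LIFT VANISHES IFF THE UNITARY DUAL PAIR'S DOES.**  For every pair datum `P` of the model on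
`↥(regimeSubgroup L V.Hm) × relNormOneIdeles` whose representation is the slot-0 line representation `lineRepOf … 0` and whose arithmetic
subgroup is `regimeRat` (e.g. `(archSideOfChar …).P 0`, `(ThetaDistAtLine.sideAt …).P 0`, by `rfl`), every finite measure `μ′` on `[U(1)]`,
every `Φ ∈ 𝒮(𝔸_{L⁺}³)`, every `f′ ∈ C([U(1)])` and every continuous `c₂` on `[U(1)]` with `c₂(t̄) = (η₀(1, t♭) · χ₀(1, e t))⁻¹`:
`P.kernelDatum.thetaLift μ′ Φ f′ ≠ 0 ↔ Θ^{UDP}_Φ((c₂ · f′) ∘ a⁻¹) ≠ 0`, the latter the lift of `cmThetaKernelDatum L e₁ (frameD V) … (lineVec (dW S 0)) … hGR₀ hρ SK hSK`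
(= S6's `UnitaryDualPair.thetaKernelDatum … (splittingOf hGR₀) …`) against the push-forward `μ′.map (cosetCongr e …)`.
[cite: Li1992, p. 178; GelbartRogawski1991, §3.1 Remark p. 457 L4–13; Weil1964, Chap. III n° 41 Thm 6 p. 193] -/
theorem kernelDatum_thetaLift_ne_zero_iff (hcont : Continuous e) (hconts : Continuous e.symm)
    (c₂ : C(↥(relNormOneIdeles (↥(maximalRealSubfield L)) L) ⧸ relNormOneRat (↥(maximalRealSubfield L)) L, ℂ))
    (hc₂ : ∀ t : ↥(relNormOneIdeles (↥(maximalRealSubfield L)) L),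
      c₂ (QuotientGroup.mk t) =
        (((η₀ (1, (cmAdelicOneEquivRelNormOne (L : Type)).symm t) *
            cmLineChar₀ (L : Type) finProdFinEquiv e₁ (frameD V) (frameD_real V) (frameD_ne V) (dW S) (dW_real S) (dW_ne S)
              hGR hGR₀ hGR₁ (1, e t))⁻¹ : ℂˣ) : ℂ))
    (Φ : piSchwartzBruhat (↥(maximalRealSubfield L)) (Fin 3))
    (f' : C(↥(relNormOneIdeles (↥(maximalRealSubfield L)) L) ⧸ relNormOneRat (↥(maximalRealSubfield L)) L, ℂ)) :
    P.kernelDatum.thetaLift μ' (P.weilDatum.toThetaTop Φ) f' ≠ 0 ↔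
      (cmThetaKernelDatum (L : Type) e₁ (frameD V) (frameD_real V) (frameD_ne V) (lineVec (L : Type) (dW S 0))
            (fun _ => dW_real S 0) (fun _ => dW_ne S 0) hGR₀ hρ SK hSK).thetaLift
          (μ'.map (cosetCongr e (relNormOneRat (↥(maximalRealSubfield L)) L)
            (CMRat (L : Type) (lineVec (L : Type) (dW S 0))) hΓ))
          Φ
          ((c₂ * f').comp
            ⟨cosetCongr e.symm (CMRat (L : Type) (lineVec (L : Type) (dW S 0)))
                (relNormOneRat (↥(maximalRealSubfield L)) L)
                (forall_symm_mem_iff e _ _ hΓ),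
              continuous_cosetCongr e.symm _ _ (forall_symm_mem_iff e _ _ hΓ) hconts⟩) ≠ 0 := by
  obtain ⟨c, hc, hT⟩ := exists_twist_lineRepOf_zero V S hGR hGR₀ hGR₁ hGR₂ hGR₃ η₀ η₁ η₂ η₃ eU heU e he
  have hU : ∀ x : ↥(regimeSubgroup L V.Hm), eU x ∈ CMRat (L : Type) (frameD V) ↔ x ∈ P.ΓU := fun x => by
    rw [hPΓ]; exact mem_CMRat_iff_mem_regimeRat V eU heU x
  have hωω' : ∀ (p : ↥(regimeSubgroup L V.Hm) × ↥(relNormOneIdeles (↥(maximalRealSubfield L)) L))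
      (Φ : piSchwartzBruhat (↥(maximalRealSubfield L)) (Fin 3)),
      P.ω p Φ = ((c p : ℂˣ) : ℂ) • cmPairRep (L : Type) e₁ (frameD V) (frameD_real V) (frameD_ne V) (lineVec (L : Type) (dW S 0))
        (fun _ => dW_real S 0) (fun _ => dW_ne S 0) hGR₀ (eU p.1, e p.2) Φ := fun p Φ => by
    rw [hPω]; exact hT p Φ
  have hc₂' : ∀ t : ↥(relNormOneIdeles (↥(maximalRealSubfield L)) L),
      c₂ (QuotientGroup.mk t) = (((c (1, t))⁻¹ : ℂˣ) : ℂ) := fun t => by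
    rw [hc₂, hc]
    simp only [map_one]
  have key := thetaLift_ne_zero_iff_of_twist (ΓU := CMRat (L : Type) (frameD V))
    (Γ := CMRat (L : Type) (lineVec (L : Type) (dW S 0))) (ΓU' := P.ΓU)
    (Γ' := relNormOneRat (↥(maximalRealSubfield L)) L)
    (cmPairRep (L : Type) e₁ (frameD V) (frameD_real V) (frameD_ne V) (lineVec (L : Type) (dW S 0)) (fun _ => dW_real S 0)
      (fun _ => dW_ne S 0) hGR₀)
    hρ
    (fun γU hγU γ hγ => cmPairRep_toHomUnits_mem_thetaStabilizer (L : Type) e₁ (frameD V) (frameD_real V) (frameD_ne V)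
      (lineVec (L : Type) (dW S 0)) (fun _ => dW_real S 0) (fun _ => dW_ne S 0) hGR₀ hγU hγ)
    SK hSK P.ω P.majorants P.toHomUnits_mem_thetaStabilizer Set.univ (fun _ _ _ => Set.mem_univ _) eU hU e hΓ c hωω' μ'
    hcont hconts c₂ hc₂' Φ f'
  exact key

/-! ## §4 The canonical carrier isomorphisms: `eU = regimeEquiv⁻¹ ≫ cmFrameEquiv`, `e = cmLineTorusEquiv` -/

omit [CompactSpace (CMAdelic (L : Type) (frameD V) ⧸ CMRat (L : Type) (frameD V))] in
/-- the canonical `U(V)`-side isomorphism `regimeSubgroup ≃* U(diag (frameD V))(𝔸)` (regime ⇒ `regimeEquiv⁻¹`, then the rational frame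
transport `cmFrameEquiv`) has the values `heU` asks for. [cite: GelbartRogawski1991, §3.1 Prop. 3.1.1 p. 455 L1–3] -/
theorem canonical_eU_apply (hV : IsAnisotropic L V.Hm) (x : ↥(regimeSubgroup L V.Hm)) :
    ((regimeEquiv L V.Hm hV).symm.trans (cmFrameEquiv (L : Type) (frameG V) V.Hm (frameD V) (frame_congr V))).toMulEquiv x =
      cmFrameEquiv (L : Type) (frameG V) V.Hm (frameD V) (frame_congr V) (x : ↥(HodgeCM.Adelic.adelicUnitaryGroup (L : Type) V.Hm)) :=
  rfl

include hPω hPΓ in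
/-- **MAIN, CANONICAL CARRIERS** — `kernelDatum_thetaLift_ne_zero_iff` at `eU := regimeEquiv⁻¹ ≫ cmFrameEquiv` and
`e := cmLineTorusEquiv L (dW S 0)` (★ `UnitaryDualPairCMLineTorus`: values `t♭ · 1₁`, continuous both ways, rational points correspond):
only the descended multiplier `c₂` is left to the consumer (★ `exists_twist_descend_right` produces it from the continuity of
`t ↦ η₀(1, t♭) · χ₀(1, t♭ · 1₁)`). [cite: Li1992, p. 178; GelbartRogawski1991, §3.1 Remark p. 457 L4–13; Weil1964, Chap. III n° 41 Thm 6 p. 193] -/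
theorem kernelDatum_thetaLift_ne_zero_iff_canonical (hV : IsAnisotropic L V.Hm)
    (c₂ : C(↥(relNormOneIdeles (↥(maximalRealSubfield L)) L) ⧸ relNormOneRat (↥(maximalRealSubfield L)) L, ℂ))
    (hc₂ : ∀ t : ↥(relNormOneIdeles (↥(maximalRealSubfield L)) L),
      c₂ (QuotientGroup.mk t) =
        (((η₀ (1, (cmAdelicOneEquivRelNormOne (L : Type)).symm t) *
            cmLineChar₀ (L : Type) finProdFinEquiv e₁ (frameD V) (frameD_real V) (frameD_ne V) (dW S) (dW_real S) (dW_ne S)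
              hGR hGR₀ hGR₁ (1, cmLineTorusEquiv (L : Type) (dW S 0) (dW_ne S 0) t))⁻¹ : ℂˣ) : ℂ))
    (Φ : piSchwartzBruhat (↥(maximalRealSubfield L)) (Fin 3))
    (f' : C(↥(relNormOneIdeles (↥(maximalRealSubfield L)) L) ⧸ relNormOneRat (↥(maximalRealSubfield L)) L, ℂ)) :
    P.kernelDatum.thetaLift μ' (P.weilDatum.toThetaTop Φ) f' ≠ 0 ↔
      (cmThetaKernelDatum (L : Type) e₁ (frameD V) (frameD_real V) (frameD_ne V) (lineVec (L : Type) (dW S 0))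
            (fun _ => dW_real S 0) (fun _ => dW_ne S 0) hGR₀ hρ SK hSK).thetaLift
          (μ'.map (cosetCongr (cmLineTorusEquiv (L : Type) (dW S 0) (dW_ne S 0))
            (relNormOneRat (↥(maximalRealSubfield L)) L) (CMRat (L : Type) (lineVec (L : Type) (dW S 0)))
            (cmLineTorusEquiv_mem_CMRat_iff (L : Type) (dW S 0) (dW_ne S 0))))
          Φ
          ((c₂ * f').comp
            ⟨cosetCongr (cmLineTorusEquiv (L : Type) (dW S 0) (dW_ne S 0)).symm (CMRat (L : Type) (lineVec (L : Type) (dW S 0)))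
                (relNormOneRat (↥(maximalRealSubfield L)) L)
                (forall_symm_mem_iff _ _ _ (cmLineTorusEquiv_mem_CMRat_iff (L : Type) (dW S 0) (dW_ne S 0))),
              continuous_cosetCongr _ _ _ (forall_symm_mem_iff _ _ _ (cmLineTorusEquiv_mem_CMRat_iff (L : Type) (dW S 0) (dW_ne S 0)))
                (continuous_cmLineTorusEquiv_symm (L : Type) (dW S 0) (dW_ne S 0))⟩) ≠ 0 :=
  kernelDatum_thetaLift_ne_zero_iff V S hGR hGR₀ hGR₁ hGR₂ hGR₃ η₀ η₁ η₂ η₃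
    ((regimeEquiv L V.Hm hV).symm.trans (cmFrameEquiv (L : Type) (frameG V) V.Hm (frameD V) (frame_congr V))).toMulEquiv
    (fun _ => rfl) (cmLineTorusEquiv (L : Type) (dW S 0) (dW_ne S 0)) (cmLineTorusEquiv_apply (L : Type) (dW S 0) (dW_ne S 0))
    P hPω hPΓ (cmLineTorusEquiv_mem_CMRat_iff (L : Type) (dW S 0) (dW_ne S 0)) hρ SK hSK μ'
    (continuous_cmLineTorusEquiv (L : Type) (dW S 0) (dW_ne S 0)) (continuous_cmLineTorusEquiv_symm (L : Type) (dW S 0) (dW_ne S 0))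
    c₂ hc₂ Φ f'

end Main

end Summit.HodgeConjecture.HodgeConjecture.Cruxes.H413.RallisTransport
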